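import Summits.ABC.IUTFork.Joshi.ATS4InitialThetaDataExistence
import Summits.ABC.IUTFork.Joshi.InitialThetaDataJoshiSupply
import Literature.IUT.LogVolume.Corollary22CondP6Transport
import HarnessLib

/-!
# [J-IV] Theorem 5.7.1 with its conclusion read at Mochizuki's `F_mod`-model — PROVED (sequel of `ATS4InitialThetaDataExistence.lean`,
# `ATS4InitialThetaDataExistenceProofs.lean`; follows the second reader's recommendation N1/N2 of E-t6, STATUS 2026-08-26T08:07:33Z)

Record file of the abc-iut cell, block E (rung LADDER-ABC:A2.E; seat abc-iut-E-t28, slot T-28). SOURCE: K. Joshi, *Construction of Arithmetic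
Teichmüller Spaces IV*, arXiv:2403.10430v2 («Preliminary version for comments», UNREFEREED) = [J-IV], Thm. 5.7.1 p.53 l.31–45 (render
`HOME/lit/renders/Joshi-arxiv-2403.10430/pNNNN.txt`). TAKES NO SIDE on [IUTchIII] Cor. 3.12, on Joshi's claims, or on Mochizuki's reports on them;
NO abc claim; typed ≠ proved ≠ endorsed. CLASSICAL throughout (no Theorem 1.10, no Θ-link).

The statement file types the conclusion «`C_λ` satisfies Initial Theta Data [Joshi, 2024c, §3.1, §3.3] … with the prime `ℓ`» (p.53 l.44–45) LITERALLY
as `HasInitialThetaData λ ℓ`: E-t6's structure `ATS3.InitialThetaData` over the LEGENDRE curve `C_λ` and EVERY theta field `L = ℚ(λ)(√−1, C_λ[15])`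
(print: «`L = L_mod(√−1, C_λ[2·3·5])`», p.53 l.40–41). Two obstacles to deriving that form are on record (module docstrings of the two earlier files,
E-t6's audit notes N1/N2): clause (9) «`L/L_mod` Galois» of [J-III] §3.3 is not recorded for an arbitrary theta field and can fail for the Legendre
model (the `ℚ(j_λ)`-conjugate `λ ↦ 1/λ` twists `C_λ` by `λ`), and no transport of `ATS3.InitialThetaData` along `C_{λ,F} ≅ W ⊗ F` is in the tree.
[IUTchIV] Cor. 2.2 (ii) (p.42) — of which Thm. 5.7.1 is «my formulation» (p.53 l.23–24) — works instead with a MODEL `E_{F_mod}` over the field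
of moduli and `F := F_mod(√−1, E_{F_mod}[2·3·5])`, Galois over `F_mod` by construction; the tree realises it as `W = modCurve λ` (`j(W) = j(λ)`),
`F = FTheta λ`, `E_F = ETheta λ = W ⊗ F`, `K = F(E_F[ℓ])` (`Literature.IUT.HodgeTheaters.InitialThetaDataTripod/…Conditions`), and E-t6's
`ATS3.InitialThetaData.nonempty_at` (p431540) inhabits Joshi's structure THERE from (P2), (P5), (P4) with no `π₁`-geometric input.

This file therefore names the MODEL READING of the conclusion, `HasInitialThetaDataMod λ ℓ := Nonempty (ATS3.InitialThetaData (FTheta λ)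
(F(E_F[ℓ])) F̄ (ETheta λ) ℓ)` (OUR READING — the object [IUTchIV] Cor. 2.2 (ii) speaks about; same `j`-invariant, same field tower up to the choice
of model), and PROVES `hasInitialThetaDataMod_of_conditions` ((P2)(P5)(P6) + core ⟹ the model reading; (P6) ⇒ (P4) by
`Cor22.not_admitsLCyclic_of_condP6`) and the transfer **`thm571Mod_of_conditions : Thm571With W (ITDConditions ∧ AdmitsCore) → Thm571With W
HasInitialThetaDataMod`** for every window `W`. Composed with `thm571Conditions_holds` of the proofs file `ATS4InitialThetaDataExistenceProofs.lean`
(p432027) this gives `Thm571With lem587Window HasInitialThetaDataMod` UNCONDITIONALLY — [J-IV] Thm. 5.7.1 with the `ℓ`-window of its own proof (Lem.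
5.8.7 (1), «`log(2·δ·Q)`», Joshi's `δ = d*_mod`) and its conclusion read at the `F_mod`-model is a theorem of the tree (the one-line composition
`thm571Mod_holds` is filed in the proof-only sequel `ATS4InitialThetaDataExistenceModelHolds.lean`, kept apart so that this file does not wait on
that module's build).
What remains between this and the AS-PRINTED `Thm571` is exactly: flag (a) (the extra logarithm in the printed window) and flag (f)/N1 (Legendre
model over an arbitrary theta field vs the `F_mod`-model) — recorded, not adjudicated (referee lane ref-x; E-cx).

[claim: Joshi2024ATS4, status: disputed] (unrefereed preprint); [claim: Joshi2024ATS3, status: disputed] for E-t6's structure; [claim: Mochizuki2012,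
status: disputed] for the [IUTchIV] decls cited BY NAME. Standard axioms only.
-/

noncomputable section

open scoped Classical
open NumberField IsDedekindDomain
open Literature.NumberTheory.DiophantineGeometry.GenEll Literature.IUT.LogVolume Literature.IUT.LogVolume.Cor22
open Literature.IUT.HodgeTheaters hiding InitialThetaData

namespace Summit.ABC.IUTFork.Joshi.ATS4

-- (forming the torsion field `F(E_F[ℓ])` over the nested subtype field `FTheta λ` needs a larger instance budget, as in the tree)
set_option synthInstance.maxHeartbeats 200000 in
/-- **MODEL READING of Thm. 5.7.1's conclusion** «`C_λ` satisfies Initial Theta Data [J-III §3.1, §3.3] … with the prime `ℓ`» (p.53 l.44–45) — OUR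
READING at the `F_mod`-model of [IUTchIV] Cor. 2.2 (ii) p.42: Joshi's structure `ATS3.InitialThetaData L L′ L̄ C ℓ` (E-t6) is INHABITED for
`L = FTheta λ = F_mod(√−1, W[2·3·5])`, `W = modCurve λ` the `F_mod = ℚ(j(λ))`-model, `C = ETheta λ = W ⊗ L`, `L′ = L(C[ℓ])` (`TorsionField`), `L̄ =
AlgebraicClosure L`. (`NeZero ℓ`, needed to form the torsion field, is part of the reading; it holds for the primes Thm. 5.7.1 produces.) Contrast the
literal `HasInitialThetaData` (Legendre curve, every theta field): neither implication between the two is proved here (transport along `C_{λ,F} ≅ W ⊗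
F` and along theta-field isomorphisms is not in the tree; E-t6 audit N1). [claim: Joshi2024ATS4, status: disputed] -/
def HasInitialThetaDataMod (P : NFPoint) (ℓ : ℕ) : Prop :=
  ∃ _ : NeZero ℓ, Nonempty (ATS3.InitialThetaData (FTheta P) (TorsionField (ETheta P) ℓ) (AlgebraicClosure (FTheta P)) (ETheta P) ℓ)

-- (instance search over the nested subtype field `FTheta λ` and the torsion field needs a larger budget, as in the tree's constructor)
set_option synthInstance.maxHeartbeats 200000 in
/-- **(P2)(P5)(P6) + core ⟹ the model reading** («All these results and properties imply that the `C_λ` is equipped with an Initial Theta Data»,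
p.57 l.23–26): for `λ ∈ U` minimally presented and a prime `ℓ` with `ITDConditions λ ℓ` and `AdmitsCore λ`, Joshi's structure is inhabited at the
`F_mod`-model — E-t6's `ATS3.InitialThetaData.nonempty_at` (p431540; (P7) in the arithmetic, no `π₁`-geometric input), fed with (P4) obtained from
(P6) over the Galois extension `F/F_tpd` of degree prime to `ℓ ≥ 7` (`Cor22.not_admitsLCyclic_of_condP6`, `isGalois_tpd`, `not_dvd_finrank_tpd`,
`modelCurve_j_eq_algebraMap_jInv`). PROVED. [claim: Joshi2024ATS4, status: disputed] -/
theorem hasInitialThetaDataMod_of_conditions {P : NFPoint} (hP : P ∈ UP) {l : ℕ} (hl : l.Prime) (h : ITDConditions P l)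
    (hcore : Cor22.AdmitsCore P) : HasInitialThetaDataMod P l := by
  haveI : NeZero l := ⟨hl.ne_zero⟩
  haveI : Fact l.Prime := ⟨hl⟩
  obtain ⟨h7, hP2, hP5, hP6⟩ := h
  letI := tpdAlgebra P hP
  haveI := isGalois_tpd P hP
  have hno : ¬ (thetaEllPt P).AdmitsLCyclic l :=
    Cor22.not_admitsLCyclic_of_condP6 hP.1 hcore (le_trans (by norm_num) h7) hP6 (FTheta P)
      (not_dvd_finrank_tpd P hP hl h7) (ETheta P) (modelCurve_j_eq_algebraMap_jInv P hP)
  exact ⟨inferInstance, ATS3.InitialThetaData.nonempty_at P hP hl h7 hP2 hP5 hno⟩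

/-- **Transfer to the model reading**: for every `ℓ`-window `W`, Thm. 5.7.1 with the arithmetic conclusion `ITDConditions ∧ AdmitsCore` implies
Thm. 5.7.1 with the conclusion read at the `F_mod`-model (same `Exc`, same `ℓ`; the points of `Z ∩ U(Q̄)_{≤d}` are minimally presented, `UPle d ⊆ UP`).
With `thm571Conditions_holds` (proofs file, p432027) this yields `Thm571With lem587Window HasInitialThetaDataMod` unconditionally. PROVED.
[claim: Joshi2024ATS4, status: disputed] -/
theorem thm571Mod_of_conditions {W : NFPoint → ℕ → Prop}
    (h : Thm571With W (fun P ℓ => ITDConditions P ℓ ∧ Cor22.AdmitsCore P)) : Thm571With W HasInitialThetaDataMod := by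
  intro Z h2 h562 d hd
  obtain ⟨Exc, hfin, hsub, hmain⟩ := h Z h2 h562 d hd
  refine ⟨Exc, hfin, hsub, fun P hP hPexc => ?_⟩
  obtain ⟨ℓ, hℓ, hW, hI, hcore⟩ := hmain P hP hPexc
  exact ⟨ℓ, hℓ, hW, hasInitialThetaDataMod_of_conditions hP.2.1 hℓ hI hcore⟩

end Summit.ABC.IUTFork.Joshi.ATS4

end
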